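import Mathlib
import Summits.Ventures.PercRepro2.HCovTyped
import Summits.Ventures.PercRepro2.TwoMarkHubCert

/-!
# Row 2′TRI and (HCOV) on the three two-mark hubs (blind cell PercRepro2, mine-2 g40,
2026-08-28; `proofs/MINE2-HUBK5.md` §4, row M2-85)

**`typedCount_nonneg_of_hub`**: on every finite graph in which two of the marks `o, a₃, b` are
adjacent only to marks (a hub: the `IsHub` structure of `TwoMarkHubConn.lean`, at most one edge to
each other mark), every typed base of `K₃` is nonnegative — the gluing theorem
(`TwoMarkHubGlue.lean`) with the certificate from `K₅` (`TwoMarkHubK5.lean`).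
**`TypedBases_of_hub`**, **`HCov_of_hub`**: row 2′TRI and (HCOV) for every admissible weight
vector.  The three hubs by name — `HCov_of_poleHub` (`o` and `b`), `HCov_of_hubOA3` (`o` and
`a₃`), `HCov_of_hubBA3` (`b` and `a₃`) — with the hub spelled out edge by edge
(`isHub_ob` / `isHub_oa3` / `isHub_ba3`), the marks pairwise distinct.  These are M2-81's pole
hub and M2-82's two `a₃`-hubs as kernel theorems; the pairs with a root are not hubs
(`proofs/MINE2-HUBK5.md` §5).  Own code; standard axioms.
-/

namespace Summit.Ventures.PercRepro2

open UnionCluster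

namespace CovForm

namespace THub

open OneTyped Untouched OStar K5 TypedFactor SepThree TypedRed

section Main

variable {V : Type*} {E : Type*} [Fintype E] [DecidableEq V] [DecidableEq E]
variable {ends : E → Sym2 V} {o a₁ a₂ a₃ b : V} {h : HubType} {slot : Fin 7 → Option E}
  {R : Type*} [Field R] [LinearOrder R] [IsStrictOrderedRing R]

/-- **Row 2′TRI on a hub**: every typed base of `K₃` is nonnegative. -/
theorem typedCount_nonneg_of_hub (hH : IsHub ends o a₁ a₂ a₃ b h slot) (F : Finset E)
    (z : Config E) (τ : E → ℕ) :
    0 ≤ typedCount F z τ (K3 ends o a₁ a₂ a₃ b : Config E → Config E → Config E → R) := by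
  have h6 : 0 ≤ 6 * typedCount F z τ (K3 ends o a₁ a₂ a₃ b : Config E → Config E → Config E → R) := by
    rw [six_mul_typedCount_eq hH F z τ]
    refine Finset.sum_nonneg fun xb _ => Finset.sum_nonneg fun yb _ =>
      Finset.sum_nonneg fun wb _ => ?_
    split_ifs
    · exact Int.cast_nonneg (C_nonneg h _ (valid_pat xb) (valid_pat yb) (valid_pat wb))
    · exact le_refl 0
  exact (mul_nonneg_iff_of_pos_left (by norm_num : (0 : R) < 6)).1 h6

/-- **The typed bases on a hub** (row 2′TRI as a class theorem). -/
theorem TypedBases_of_hub (hH : IsHub ends o a₁ a₂ a₃ b h slot) :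
    TypedBases (R := R) ends o a₁ a₂ a₃ b :=
  fun F z τ _ => typedCount_nonneg_of_hub hH F z τ

/-- **(HCOV) on a hub** for every admissible weight vector. -/
theorem HCov_of_hub (hH : IsHub ends o a₁ a₂ a₃ b h slot) (p : E → R) (hp : IsProbVec p) :
    HCov p ends o a₁ a₂ a₃ b :=
  HCov_of_typedBases ends o a₁ a₂ a₃ b (TypedBases_of_hub hH) p hp

end Main

/-! ## The three hubs spelled out -/

section Named

variable {V : Type*} {E : Type*} [Fintype E] [DecidableEq V] [DecidableEq E]
variable {ends : E → Sym2 V} {o a₁ a₂ a₃ b : V} {slot : Fin 7 → Option E}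
  {R : Type*} [Field R] [LinearOrder R] [IsStrictOrderedRing R]

omit [Fintype E] [DecidableEq V] [DecidableEq E] in
/-- Five pairwise distinct marks give an injective marking. -/
lemma mark_injective (h01 : o ≠ a₁) (h02 : o ≠ a₂) (h03 : o ≠ a₃) (h04 : o ≠ b) (h12 : a₁ ≠ a₂)
    (h13 : a₁ ≠ a₃) (h14 : a₁ ≠ b) (h23 : a₂ ≠ a₃) (h24 : a₂ ≠ b) (h34 : a₃ ≠ b) :
    Function.Injective (mark o a₁ a₂ a₃ b) := by
  intro i j hij
  fin_cases i <;> fin_cases j <;> simp only [mark] at hij <;> first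
    | rfl
    | exact absurd hij h01 | exact absurd hij.symm h01
    | exact absurd hij h02 | exact absurd hij.symm h02
    | exact absurd hij h03 | exact absurd hij.symm h03
    | exact absurd hij h04 | exact absurd hij.symm h04
    | exact absurd hij h12 | exact absurd hij.symm h12
    | exact absurd hij h13 | exact absurd hij.symm h13
    | exact absurd hij h14 | exact absurd hij.symm h14
    | exact absurd hij h23 | exact absurd hij.symm h23
    | exact absurd hij h24 | exact absurd hij.symm h24
    | exact absurd hij h34 | exact absurd hij.symm h34

omit [Fintype E] [DecidableEq V] [DecidableEq E] in
/-- **The pole hub `(o, b)` spelled out**: optional edges `o–a₁, o–a₂, o–a₃, o–b, a₁–b, a₂–b,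
a₃–b` (in this order), every edge at `o` or `b` one of them, the marks pairwise distinct. -/
lemma isHub_ob (h₀ : ∀ e, slot 0 = some e → ends e = s(o, a₁))
    (h₁ : ∀ e, slot 1 = some e → ends e = s(o, a₂)) (h₂ : ∀ e, slot 2 = some e → ends e = s(o, a₃))
    (h₃ : ∀ e, slot 3 = some e → ends e = s(o, b)) (h₄ : ∀ e, slot 4 = some e → ends e = s(a₁, b))
    (h₅ : ∀ e, slot 5 = some e → ends e = s(a₂, b)) (h₆ : ∀ e, slot 6 = some e → ends e = s(a₃, b))
    (all : ∀ e, o ∈ ends e ∨ b ∈ ends e → ∃ i, slot i = some e)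
    (h01 : o ≠ a₁) (h02 : o ≠ a₂) (h03 : o ≠ a₃) (h04 : o ≠ b) (h12 : a₁ ≠ a₂) (h13 : a₁ ≠ a₃)
    (h14 : a₁ ≠ b) (h23 : a₂ ≠ a₃) (h24 : a₂ ≠ b) (h34 : a₃ ≠ b) :
    IsHub ends o a₁ a₂ a₃ b .ob slot where
  hslot := by
    intro i e hi
    fin_cases i
    · rw [h₀ e hi]; rfl
    · rw [h₁ e hi]; rfl
    · rw [h₂ e hi]; rfl
    · rw [h₃ e hi]; rfl
    · rw [h₄ e hi]; rfl
    · rw [h₅ e hi]; rfl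
    · rw [h₆ e hi]; rfl
  all := all
  inj := mark_injective h01 h02 h03 h04 h12 h13 h14 h23 h24 h34

omit [Fintype E] [DecidableEq V] [DecidableEq E] in
/-- **The hub `(o, a₃)` spelled out**: optional edges `o–a₁, o–a₂, o–a₃, o–b, a₁–a₃, a₂–a₃,
a₃–b`, every edge at `o` or `a₃` one of them, the marks pairwise distinct. -/
lemma isHub_oa3 (h₀ : ∀ e, slot 0 = some e → ends e = s(o, a₁))
    (h₁ : ∀ e, slot 1 = some e → ends e = s(o, a₂)) (h₂ : ∀ e, slot 2 = some e → ends e = s(o, a₃))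
    (h₃ : ∀ e, slot 3 = some e → ends e = s(o, b)) (h₄ : ∀ e, slot 4 = some e → ends e = s(a₁, a₃))
    (h₅ : ∀ e, slot 5 = some e → ends e = s(a₂, a₃)) (h₆ : ∀ e, slot 6 = some e → ends e = s(a₃, b))
    (all : ∀ e, o ∈ ends e ∨ a₃ ∈ ends e → ∃ i, slot i = some e)
    (h01 : o ≠ a₁) (h02 : o ≠ a₂) (h03 : o ≠ a₃) (h04 : o ≠ b) (h12 : a₁ ≠ a₂) (h13 : a₁ ≠ a₃)
    (h14 : a₁ ≠ b) (h23 : a₂ ≠ a₃) (h24 : a₂ ≠ b) (h34 : a₃ ≠ b) :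
    IsHub ends o a₁ a₂ a₃ b .oa3 slot where
  hslot := by
    intro i e hi
    fin_cases i
    · rw [h₀ e hi]; rfl
    · rw [h₁ e hi]; rfl
    · rw [h₂ e hi]; rfl
    · rw [h₃ e hi]; rfl
    · rw [h₄ e hi]; rfl
    · rw [h₅ e hi]; rfl
    · rw [h₆ e hi]; rfl
  all := all
  inj := mark_injective h01 h02 h03 h04 h12 h13 h14 h23 h24 h34

omit [Fintype E] [DecidableEq V] [DecidableEq E] in
/-- **The hub `(b, a₃)` spelled out**: optional edges `o–a₃, o–b, a₁–a₃, a₁–b, a₂–a₃, a₂–b,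
a₃–b`, every edge at `b` or `a₃` one of them, the marks pairwise distinct. -/
lemma isHub_ba3 (h₀ : ∀ e, slot 0 = some e → ends e = s(o, a₃))
    (h₁ : ∀ e, slot 1 = some e → ends e = s(o, b)) (h₂ : ∀ e, slot 2 = some e → ends e = s(a₁, a₃))
    (h₃ : ∀ e, slot 3 = some e → ends e = s(a₁, b)) (h₄ : ∀ e, slot 4 = some e → ends e = s(a₂, a₃))
    (h₅ : ∀ e, slot 5 = some e → ends e = s(a₂, b)) (h₆ : ∀ e, slot 6 = some e → ends e = s(a₃, b))
    (all : ∀ e, b ∈ ends e ∨ a₃ ∈ ends e → ∃ i, slot i = some e)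
    (h01 : o ≠ a₁) (h02 : o ≠ a₂) (h03 : o ≠ a₃) (h04 : o ≠ b) (h12 : a₁ ≠ a₂) (h13 : a₁ ≠ a₃)
    (h14 : a₁ ≠ b) (h23 : a₂ ≠ a₃) (h24 : a₂ ≠ b) (h34 : a₃ ≠ b) :
    IsHub ends o a₁ a₂ a₃ b .ba3 slot where
  hslot := by
    intro i e hi
    fin_cases i
    · rw [h₀ e hi]; rfl
    · rw [h₁ e hi]; rfl
    · rw [h₂ e hi]; rfl
    · rw [h₃ e hi]; rfl
    · rw [h₄ e hi]; rfl
    · rw [h₅ e hi]; rfl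
    · rw [h₆ e hi]; rfl
  all := all
  inj := mark_injective h01 h02 h03 h04 h12 h13 h14 h23 h24 h34

/-- **(HCOV) on the pole hub**: when every edge at `o` and every edge at `b` leads to a mark (at
most one edge to each), for every admissible weight vector. -/
theorem HCov_of_poleHub (hH : IsHub ends o a₁ a₂ a₃ b .ob slot) (p : E → R) (hp : IsProbVec p) :
    HCov p ends o a₁ a₂ a₃ b :=
  HCov_of_hub hH p hp

/-- **(HCOV) on the hub `(o, a₃)`**: when every edge at `o` and every edge at `a₃` leads to a
mark (at most one edge to each), for every admissible weight vector. -/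
theorem HCov_of_hubOA3 (hH : IsHub ends o a₁ a₂ a₃ b .oa3 slot) (p : E → R) (hp : IsProbVec p) :
    HCov p ends o a₁ a₂ a₃ b :=
  HCov_of_hub hH p hp

/-- **(HCOV) on the hub `(b, a₃)`**: when every edge at `b` and every edge at `a₃` leads to a
mark (at most one edge to each), for every admissible weight vector. -/
theorem HCov_of_hubBA3 (hH : IsHub ends o a₁ a₂ a₃ b .ba3 slot) (p : E → R) (hp : IsProbVec p) :
    HCov p ends o a₁ a₂ a₃ b :=
  HCov_of_hub hH p hp

end Named

end THub

end CovForm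

end Summit.Ventures.PercRepro2
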